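import Mathlib
import Summits.Ventures.HodgeRepro2.T5PrincipalUnitFiltration

/-!
# The comparison `U_{S,n} U_R ⊋ U_{S,n+1} U_R` for an extension of discrete valuation rings
(kernel witness for the second half of the local statement (A10) of the Tier-5 [A]-ledger:
«`U_E^{a−1}/U_E^a ≅ k_E`, strictly larger than the image of `U_{F_v}`»)

`T5PrincipalUnitFiltration` (imported) gives `U_n/U_{n+1} ≅ (k, +)` for one discrete valuation
ring.  At an INERT place `v` of `E/F`, `𝒪_{F_v} → 𝒪_{E_v}` is an extension of discrete valuation
rings with a COMMON uniformiser `ϖ` and residue degree `2`, so the residue map `k_F → k_E` is not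
surjective; this file proves that under exactly these hypotheses the higher unit groups of the
extension are strictly larger than those of the base modulo the next step:

* `unitsMap`, `residueMap` — the maps `Rˣ → Sˣ` and `R/(ϖ) → S/(ϖ)`;
* `toResidue_mem_range_of_mem_range` — for `w ∈ U_{S,n}` coming from `Rˣ`, `toResidue w` lies in
  the image of `R/(ϖ)` (needs `ϖ`-saturation at level `n`: `ϖ_S^n ∣ algebraMap r ⇒ ϖ^n ∣ r`);
* `exists_mem_higherUnits_not_mem_sup` — **if the residue map is not surjective, some
  `u ∈ U_{S,n}` is not in `U_{S,n+1} ⊔ (image of Rˣ)`** (`n ≥ 1`; local domain `S`,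
  `0 ≠ ϖ_S ∈ 𝔪_S`);
* `dvd_of_dvd_algebraMap` — saturation holds for an injective map of discrete valuation rings with
  a common uniformiser (valuations are preserved: `r = u ϖ^m` maps to `u ϖ_S^m`);
* `exists_mem_higherUnits_not_mem_sup_of_dvr` — the statement for discrete valuation rings.

Hence: `U_E^{n} U_F ⊋ U_E^{n+1} U_F` for every `n ≥ 1` at an inert place (with `U_E^0 = 𝒪_E^×`,
the case `a = 1` of (A10) is `Rˣ/U_1 ≅ k_E^× ⊋ k_F^×`, read off from
`unitsQuotEquivResidueFieldUnits` in the same way; not repeated here).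
Not modelled: the local fields themselves; the residue degree (the non-surjectivity of the residue
map is the hypothesis).  Imports: Mathlib + one accepted file of this prefix; axioms standard.
Uses an L-value-free non-vanishing device: NO (README §8(d)).
-/
namespace Summit.Ventures.HodgeRepro2.T5PrincipalUnitComparison

open Summit.Ventures.HodgeRepro2.T5PrincipalUnitFiltration

section Comparison

variable {R S : Type*} [CommRing R] [CommRing S] [Algebra R S] (ϖ : R) (n : ℕ)

/-- The image of `Rˣ` in `Sˣ`. -/
noncomputable def unitsMap : Rˣ →* Sˣ := Units.map (algebraMap R S).toMonoidHom

/-- `(ϖ) ≤ (ϖ_S)` pulled back: the hypothesis for `Ideal.quotientMap`. -/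
theorem span_le_comap :
    Ideal.span {ϖ} ≤ (Ideal.span {algebraMap R S ϖ}).comap (algebraMap R S) := by
  rw [Ideal.span_le]
  intro x hx
  rw [Set.mem_singleton_iff] at hx
  subst hx
  exact Ideal.mem_comap.mpr (Ideal.mem_span_singleton_self _)

/-- The residue map `R/(ϖ) → S/(ϖ_S)`. -/
noncomputable def residueMap : R ⧸ Ideal.span {ϖ} →+* S ⧸ Ideal.span {algebraMap R S ϖ} :=
  Ideal.quotientMap (Ideal.span {algebraMap R S ϖ}) (algebraMap R S) (span_le_comap ϖ)

/-- `residueMap (mk r) = mk (algebraMap r)`. -/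
theorem residueMap_mk (r : R) :
    residueMap ϖ (Ideal.Quotient.mk (Ideal.span {ϖ}) r) =
      Ideal.Quotient.mk (Ideal.span {algebraMap R S ϖ}) (algebraMap R S r) :=
  rfl

variable [IsDomain S]

/-- If `w ∈ U_{S,n}` comes from `Rˣ` and the extension is `ϖ`-saturated at level `n`
(`ϖ_S^n ∣ algebraMap r ⇒ ϖ^n ∣ r`), then `toResidue w` lies in the image of `R/(ϖ)`. -/
theorem toResidue_mem_range_of_mem_range (hϖS : algebraMap R S ϖ ≠ 0) (hn : 1 ≤ n)
    (hsat : ∀ r : R, algebraMap R S ϖ ^ n ∣ algebraMap R S r → ϖ ^ n ∣ r)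
    (w : higherUnits (algebraMap R S ϖ) n) (r : Rˣ) (hw : (w : Sˣ) = unitsMap r) :
    ∃ y : R ⧸ Ideal.span {ϖ},
      Multiplicative.ofAdd (residueMap ϖ y) = toResidue (algebraMap R S ϖ) n hϖS hn w := by
  have hw' : ((w : Sˣ) : S) = algebraMap R S (r : R) := by
    rw [hw]
    rfl
  have hdvd : algebraMap R S ϖ ^ n ∣ algebraMap R S ((r : R) - 1) := by
    rw [map_sub, map_one, ← hw']
    exact w.2
  obtain ⟨c, hc⟩ := hsat _ hdvd
  refine ⟨Ideal.Quotient.mk _ c, ?_⟩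
  rw [toResidue_apply, residueMap_mk]
  congr 2
  apply eq_cofactor _ n hϖS w
  rw [hw', ← map_one (algebraMap R S), ← map_sub, hc, map_mul, map_pow]

/-- **The comparison.** Over a local domain `S` with `0 ≠ ϖ_S ∈ 𝔪_S`, if the extension is
`ϖ`-saturated at level `n ≥ 1` and the residue map `R/(ϖ) → S/(ϖ_S)` is NOT surjective, then
`U_{S,n}` is not contained in `U_{S,n+1} · (image of Rˣ)`: some `u ∈ U_{S,n}` has
`u ∉ U_{S,n+1} ⊔ unitsMap.range`.  (At an inert place of `E/F` with `R = 𝒪_{F_v}`,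
`S = 𝒪_{E_v}`, `ϖ` a common uniformiser: `U_E^{n} U_F ⊋ U_E^{n+1} U_F`.) -/
theorem exists_mem_higherUnits_not_mem_sup [IsLocalRing S] (hϖS : algebraMap R S ϖ ≠ 0)
    (hϖ : algebraMap R S ϖ ∈ IsLocalRing.maximalIdeal S) (hn : 1 ≤ n)
    (hsat : ∀ r : R, algebraMap R S ϖ ^ n ∣ algebraMap R S r → ϖ ^ n ∣ r)
    (hne : ¬ Function.Surjective (residueMap (S := S) ϖ)) :
    ∃ u ∈ higherUnits (algebraMap R S ϖ) n,
      u ∉ higherUnits (algebraMap R S ϖ) (n + 1) ⊔ (unitsMap (R := R) (S := S)).range := by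
  rw [Function.Surjective, not_forall] at hne
  obtain ⟨y, hy⟩ := hne
  obtain ⟨u, hu⟩ := toResidue_surjective (algebraMap R S ϖ) n hϖS hϖ hn (Multiplicative.ofAdd y)
  refine ⟨u, u.2, fun hmem => ?_⟩
  rw [Subgroup.mem_sup] at hmem
  obtain ⟨v, hv, w, hw, hvw⟩ := hmem
  obtain ⟨r, hr⟩ := hw
  -- `w = v⁻¹ u ∈ U_{S,n}`
  have hwn : w ∈ higherUnits (algebraMap R S ϖ) n := by
    have : w = v⁻¹ * u := by rw [← hvw, inv_mul_cancel_left]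
    rw [this]
    exact Subgroup.mul_mem _ (Subgroup.inv_mem _ (higherUnits_succ_le _ n hv)) u.2
  have hvn : v ∈ higherUnits (algebraMap R S ϖ) n := higherUnits_succ_le _ n hv
  -- `u = v * w` in the subgroup `U_{S,n}`
  have huvw : u = ⟨v, hvn⟩ * ⟨w, hwn⟩ := by
    apply Subtype.ext
    simp [hvw]
  have hv1 : toResidue (algebraMap R S ϖ) n hϖS hn ⟨v, hvn⟩ = 1 :=
    (toResidue_eq_one_iff _ n hϖS hn _).mpr hv
  obtain ⟨y', hy'⟩ := toResidue_mem_range_of_mem_range ϖ n hϖS hn hsat ⟨w, hwn⟩ r hr.symm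
  apply hy
  refine ⟨y', ?_⟩
  rw [huvw, map_mul, hv1, one_mul, ← hy'] at hu
  exact Multiplicative.ofAdd.injective hu

end Comparison

section DVR

variable {R S : Type*} [CommRing R] [CommRing S] [Algebra R S] [IsDomain R] [IsDomain S]
  [IsDiscreteValuationRing R] [IsDiscreteValuationRing S] (ϖ : R)

/-- **Saturation for discrete valuation rings.** If `R → S` is an injective map of discrete
valuation rings and `ϖ` is a uniformiser of both (`E_v/F_v` unramified, e.g. inert), then
`ϖ_S^n ∣ algebraMap r ⇒ ϖ^n ∣ r`: valuations are preserved. -/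
theorem dvd_of_dvd_algebraMap (hinj : Function.Injective (algebraMap R S)) (hϖ : Irreducible ϖ)
    (hϖS : Irreducible (algebraMap R S ϖ)) (n : ℕ) (r : R)
    (h : algebraMap R S ϖ ^ n ∣ algebraMap R S r) : ϖ ^ n ∣ r := by
  rcases eq_or_ne r 0 with rfl | hr
  · exact dvd_zero _
  obtain ⟨m, u, hu⟩ := IsDiscreteValuationRing.eq_unit_mul_pow_irreducible hr hϖ
  obtain ⟨t, ht⟩ := h
  have ht0 : t ≠ 0 := by
    rintro rfl
    rw [mul_zero, ← map_zero (algebraMap R S)] at ht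
    exact hr (hinj ht)
  obtain ⟨k, v, hv⟩ := IsDiscreteValuationRing.eq_unit_mul_pow_irreducible ht0 hϖS
  have key : ((unitsMap u : Sˣ) : S) * algebraMap R S ϖ ^ m = (v : S) * algebraMap R S ϖ ^ (n + k) := by
    have h1 : ((unitsMap u : Sˣ) : S) = algebraMap R S (u : R) := rfl
    rw [h1, ← map_pow, ← map_mul, ← hu, ht, hv, pow_add]
    ring
  have hmn : m = n + k := IsDiscreteValuationRing.unit_mul_pow_congr_pow hϖS hϖS _ v m (n + k) key
  have : ϖ ^ m ∣ r := ⟨u, by rw [hu]; ring⟩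
  exact dvd_trans (pow_dvd_pow ϖ (by omega)) this

/-- **(A10), local half, for discrete valuation rings.** `R → S` injective, `ϖ` a common
uniformiser, residue map `R/(ϖ) → S/(ϖ)` not surjective (residue degree `> 1`): for every
`n ≥ 1` some `u ∈ U_{S,n}` is not in `U_{S,n+1} · (image of Rˣ)`, i.e.
`U_{S,n} U_R ⊋ U_{S,n+1} U_R`. -/
theorem exists_mem_higherUnits_not_mem_sup_of_dvr (hinj : Function.Injective (algebraMap R S))
    (hϖ : Irreducible ϖ) (hϖS : Irreducible (algebraMap R S ϖ)) (n : ℕ) (hn : 1 ≤ n)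
    (hne : ¬ Function.Surjective (residueMap (S := S) ϖ)) :
    ∃ u ∈ higherUnits (algebraMap R S ϖ) n,
      u ∉ higherUnits (algebraMap R S ϖ) (n + 1) ⊔ (unitsMap (R := R) (S := S)).range :=
  exists_mem_higherUnits_not_mem_sup ϖ n hϖS.ne_zero
    (hϖS.maximalIdeal_eq ▸ Ideal.mem_span_singleton_self _) hn
    (fun r hr => dvd_of_dvd_algebraMap ϖ hinj hϖ hϖS n r hr) hne

end DVR

end Summit.Ventures.HodgeRepro2.T5PrincipalUnitComparison
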